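import Summits.CriticalPhenomena.PercolationContinuityZ3.Theorems.Transplant.SkelNegBParamsRootArithY
import HarnessLib

/-!
# N1 params, chain of record `NegB`, part RootArithY2: y′-run region footprints across (`regionY_trans`: fine axis 0 of region `k` inside `±(5r₀ − 2)`, the
# drift `k·v` cancelling against the levels `≈ k·m`) and the x-PREFIX prism readings without centring (`prefix_pos/prefix_neg`, `N ≤ 3`) — generic lemmas in
# the literal shapes of p3's `rootOblTWAt_negBT_y` (see part RootArithY for units and the origin relation)

builds on p205010 (kernel theorem, internal audit signed; external expert review pending) — nothing in this file uses p205010; NOTHING is claimed about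
the node `SamePDropOfSkeletonNeg₁` (OPEN).  Pure arithmetic; no definitions.
Lane `prim-bschramm-*`, seat `prim-bschramm-stmt` (gen 14); helper file (`--supports stmt-CriticalPhenomena-4575 --as helper`); ledger HOME/prim-bschramm-stmt/NEG-PARAMS.md v0.13.
[cite: KozmaNitzan2024, §4 p. 28 ((32) at the root), Lemma 11 (p. 22)] [cite: MartineauTassion2017, §4.3 Lemma 4.2]
-/

namespace Summit.CriticalPhenomena.PercolationContinuityZ3.Theorems.Transplant

namespace PlanarSkeletonNeg

namespace NegB

namespace RootArith

/-- **y′-RUN, REGION `k`, ACROSS (fine axis 0), either `σ'`**: the fine abscissa of region `k` lies in `±(5r₀ − 2)` (`r₀ = 40u`, `u ≥ 17`).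
Data: transverse window `⊆ σ'`-image of `kv − v ± ra` (`ra ≤ 3n`), level terms within `r' ≤ 7m − 1 − U`… given directly as `|X − σ'km| ≤ r'` with `r' ≤ 7m`,
`nΛ = nΛx + 4σu·nm + σ'vm + vρ`, `4|Λx| ≤ 7m`. [cite: KozmaNitzan2024, §4 p. 28] -/
theorem regionY_trans {u m n v ℓ k Λ Λx ρ σ' σu aL aH ra X1 X2 r' : ℤ} (hu : 17 ≤ u) (hn : 1 ≤ n) (hm : n * (ℓ - 1) < m)
    (hv : |v| ≤ n) (hRAℓ : 44000 ≤ ℓ) (hσ : σ' = 1 ∨ σ' = -1) (hσu : σu = 1 ∨ σu = -1)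
    (haL : k * v - v - ra ≤ aL) (haLH : aL ≤ aH) (haH : aH ≤ k * v - v + ra) (hra' : ra ≤ 3 * n)
    (hX1 : |X1 - σ' * (k * m)| ≤ r') (hX2 : |X2 - σ' * (k * m)| ≤ r') (hr' : 0 ≤ r') (hr'' : r' ≤ 7 * m)
    (hΛ : n * Λ = n * Λx + 4 * σu * n * m + σ' * v * m + v * ρ) (hρ : 0 ≤ ρ) (hρ' : ρ < n) (hΛx : 4 * |Λx| ≤ 7 * m) :
    -(5 * (40 * u) - 2) ≤ (800 * u * (800 * Λ) + 640000 * m / 2) / (640000 * m) +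
        (800 * u * (800 * (m * (min (σ' * aL) (σ' * aH)) - max (v * X1) (v * X2)) / n)) / (640000 * m) ∧
      (800 * u * (800 * Λ) + 640000 * m / 2) / (640000 * m) +
        (800 * u * (800 * (m * (max (σ' * aL) (σ' * aH)) - min (v * X1) (v * X2)) / n)) / (640000 * m) + 1 ≤ 5 * (40 * u) - 2 := by
  have hn0 : 0 < n := by linarith
  have hm0 : 0 < m := by
    have := mul_le_mul_of_nonneg_left (show (0:ℤ) ≤ ℓ - 1 by linarith) hn0.le
    linarith
  have hu0 : 0 ≤ u := by linarith
  have hm4 : 40000 * n ≤ m := by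
    have := mul_le_mul_of_nonneg_left (show (43999:ℤ) ≤ ℓ - 1 by linarith) hn0.le
    linarith
  set ca := σ' * (k * v - v) with hca
  have hamin : ca - ra ≤ min (σ' * aL) (σ' * aH) ∧ max (σ' * aL) (σ' * aH) ≤ ca + ra := by
    rcases hσ with rfl | rfl
    · simp only [one_mul] at hca ⊢; rw [min_eq_left haLH, max_eq_right haLH, hca]; constructor <;> linarith
    · simp only [neg_mul, one_mul] at hca ⊢
      rw [min_eq_right (by linarith : -aH ≤ -aL), max_eq_left (by linarith : -aH ≤ -aL), hca]; constructor <;> linarith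
  set cβ := σ' * (k * m) with hcβ
  obtain ⟨w1, w1'⟩ := mul_window (v := v) hX1
  obtain ⟨w2, w2'⟩ := mul_window (v := v) hX2
  have hBmax : max (v * X1) (v * X2) ≤ v * cβ + |v| * r' := max_le w1 w2
  have hBmin : v * cβ - |v| * r' ≤ min (v * X1) (v * X2) := le_min w1' w2'
  set Bmax := max (v * X1) (v * X2)
  set Bmin := min (v * X1) (v * X2)
  set amin := min (σ' * aL) (σ' * aH)
  set amax := max (σ' * aL) (σ' * aH)
  have hElo : m * amin - Bmax ≥ -(σ' * (m * v)) - m * ra - |v| * r' := by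
    have h1 := mul_le_mul_of_nonneg_left hamin.1 hm0.le
    have e : m * (ca - ra) - (v * cβ + |v| * r') = -(σ' * (m * v)) - m * ra - |v| * r' := by rw [hca, hcβ]; ring
    linarith
  have hEhi : m * amax - Bmin ≤ -(σ' * (m * v)) + m * ra + |v| * r' := by
    have h1 := mul_le_mul_of_nonneg_left hamin.2 hm0.le
    have e : m * (ca + ra) - (v * cβ - |v| * r') = -(σ' * (m * v)) + m * ra + |v| * r' := by rw [hca, hcβ]; ring
    linarith
  have hvr : |v| * r' ≤ n * (7 * m) := mul_le_mul hv hr'' hr' hn0.le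
  -- the origin
  obtain ⟨f1, f2⟩ := coarse_bounds (u := u) (Λ := Λ) hm0
  set F := (800 * u * (800 * Λ) + 640000 * m / 2) / (640000 * m)
  have hΛx4 := abs_le.1 (show |4 * Λx| ≤ 7 * m by rw [abs_mul]; simpa using hΛx)
  have hvρ : |v * ρ| ≤ n * n := by rw [abs_mul, abs_of_nonneg hρ]; exact mul_le_mul hv hρ'.le hρ hn0.le
  obtain ⟨hvρ1, hvρ2⟩ := abs_le.1 hvρ
  have hσ'v : |σ' * (m * v)| ≤ m * n := by
    have : |σ'| = 1 := by rcases hσ with h | h <;> simp [h]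
    rw [abs_mul, this, one_mul, abs_mul, abs_of_pos hm0]; exact mul_le_mul_of_nonneg_left hv hm0.le
  have hF1 : n * (2 * m * F) ≤ n * (2 * u * Λ + m) := mul_le_mul_of_nonneg_left f1 hn0.le
  have hF2 : n * (2 * u * Λ + m) < n * (2 * m * F + 2 * m) := mul_lt_mul_of_pos_left f2 hn0
  have euΛ : u * (n * Λ) = u * (n * Λx) + 4 * u * σu * (n * m) + u * σ' * (v * m) + u * (v * ρ) := by rw [hΛ]; ring
  have hσu8 : u * σu * (n * m) ≥ -(u * (n * m)) ∧ u * σu * (n * m) ≤ u * (n * m) := by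
    have hX : 0 ≤ u * (n * m) := by positivity
    have e : u * σu * (n * m) = σu * (u * (n * m)) := by ring
    rw [e]; rcases hσu with h | h <;> rw [h] <;> constructor <;> linarith
  have t1 := mul_le_mul_of_nonneg_left hΛx4.1 (mul_nonneg hu0 hn0.le)
  have t1' := mul_le_mul_of_nonneg_left hΛx4.2 (mul_nonneg hu0 hn0.le)
  have t2 := mul_le_mul_of_nonneg_left hra' (mul_nonneg hu0 hm0.le)
  have t3 := mul_le_mul_of_nonneg_left hvr hu0
  have t4 := mul_le_mul_of_nonneg_left hvρ1 hu0
  have t4' := mul_le_mul_of_nonneg_left hvρ2 hu0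
  have t5 := mul_le_mul_of_nonneg_left hm4 (mul_nonneg hu0 hn0.le)
  have t6 : 0 ≤ u * (n * m) := by positivity
  have t7 : 17 * (n * m) ≤ u * (n * m) := mul_le_mul_of_nonneg_right hu (by positivity)
  have t10 := mul_le_mul_of_nonneg_left (show (1:ℤ) ≤ m from hm0) (mul_nonneg hu0 hn0.le)
  constructor
  · obtain ⟨-, g2⟩ := incr_bounds (u := u) (m := m) (n := n) (a := amin) (B := Bmax) hu0 hm0 hn0
    set G := 800 * u * (800 * (m * amin - Bmax) / n) / (640000 * m)
    have k1 : 800 * m * n * G ≥ 800 * u * (-(σ' * (m * v)) - m * ra - |v| * r') - u * n - 800 * m * n := by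
      have := mul_le_mul_of_nonneg_left hElo (by positivity : (0:ℤ) ≤ 800 * u); linarith
    have key : 800 * m * n * (F + G + 5 * (40 * u) - 2) > 0 := by
      have e : 800 * m * n * (F + G + 5 * (40 * u) - 2) = 400 * (n * (2 * m * F)) + 800 * m * n * G + 160000 * (u * (n * m)) - 1600 * (m * n) := by ring
      rw [e]
      have eΛ : n * (2 * u * Λ + m) = 2 * (u * (n * Λ)) + n * m := by ring
      rw [eΛ] at hF2
      have hF2' : 400 * (n * (2 * m * F)) > 800 * (u * (n * Λ)) + 400 * (n * m) - 800 * (m * n) := by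
        have : n * (2 * m * F + 2 * m) = n * (2 * m * F) + 2 * (m * n) := by ring
        rw [this] at hF2; linarith
      rw [euΛ] at hF2'
      linarith [hσu8.1, t1, t2, t3, t4, t5, t6, t7, t10, k1, hF2']
    have hmn : (0 : ℤ) < 800 * m * n := by positivity
    have hX : 0 < F + G + 5 * (40 * u) - 2 := by
      by_contra hc; push Not at hc
      have := mul_nonpos_of_nonneg_of_nonpos hmn.le hc
      linarith
    linarith
  · obtain ⟨g1, -⟩ := incr_bounds (u := u) (m := m) (n := n) (a := amax) (B := Bmin) hu0 hm0 hn0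
    set G := 800 * u * (800 * (m * amax - Bmin) / n) / (640000 * m)
    have k1 : m * n * G ≤ u * (-(σ' * (m * v)) + m * ra + |v| * r') := by
      have := mul_le_mul_of_nonneg_left hEhi hu0; linarith
    have key : 2 * m * n * (F + G + 3 - 5 * (40 * u)) < 0 := by
      have e : 2 * m * n * (F + G + 3 - 5 * (40 * u)) = n * (2 * m * F) + 2 * (m * n * G) + 6 * (m * n) - 400 * (u * (n * m)) := by ring
      rw [e]
      have eΛ : n * (2 * u * Λ + m) = 2 * (u * (n * Λ)) + n * m := by ring
      rw [eΛ, euΛ] at hF1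
      linarith [hσu8.2, t1', t2, t3, t4', t5, t6, t7, t10, k1, hF1]
    have hmn : (0 : ℤ) < 2 * m * n := by positivity
    have hX : F + G + 3 - 5 * (40 * u) < 0 := by
      by_contra hc; push Not at hc
      have := mul_nonneg hmn.le hc
      linarith
    linarith

/-- **x-PREFIX PRISM ALONG, `σ = 1`, short run** (`N ≤ 3`, no centring): inside `[−5r₀+1, 25r₀−1]`. [cite: KozmaNitzan2024, §4 p. 28] -/
theorem prefix_pos {u m n su v ℓ W RA Lb q N Λ : ℤ} (hu : 1 ≤ u) (hn : 1 ≤ n) (hm : n * (ℓ - 1) < m) (hsu : n ≤ su) (hsu' : su ≤ 11 * n)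
    (hv : |v| ≤ n) (hW : su * W ≤ n * ℓ + su) (hW0 : 0 ≤ W) (hLb : su * Lb ≤ 3 * (n * ℓ) + su) (hLb0 : 0 ≤ Lb)
    (hRA : 0 ≤ RA) (hRAn : 2000 * (RA + 2) ≤ n) (hRAℓ : 22000 * (RA + 2) ≤ ℓ)
    (hq : 0 ≤ q) (hq' : 4 * q ≤ n) (hN : 0 ≤ N) (hN3 : N ≤ 3) (hΛ : |Λ| ≤ 3 * m) :
    -(5 * (40 * u)) + 1 ≤ (800 * u * (800 * Λ) + 640000 * m / 2) / (640000 * m) +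
        (800 * u * (800 * (m * (min (1 * (-q - (N + 1) * RA - n)) (1 * (N * n + q + (N + 1) * RA + n))) -
          max (v * (su * (min (1 * (-(W + (N + 1) * RA + Lb))) (1 * (W + (N + 1) * RA + Lb)) - 1))) (v * (su * (max (1 * (-(W + (N + 1) * RA + Lb))) (1 * (W + (N + 1) * RA + Lb))) + su - 1))) / n)) /
          (640000 * m) ∧
      (800 * u * (800 * Λ) + 640000 * m / 2) / (640000 * m) +
        (800 * u * (800 * (m * (max (1 * (-q - (N + 1) * RA - n)) (1 * (N * n + q + (N + 1) * RA + n))) -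
          min (v * (su * (min (1 * (-(W + (N + 1) * RA + Lb))) (1 * (W + (N + 1) * RA + Lb)) - 1))) (v * (su * (max (1 * (-(W + (N + 1) * RA + Lb))) (1 * (W + (N + 1) * RA + Lb))) + su - 1))) / n)) /
          (640000 * m) + 1 ≤ 25 * (40 * u) - 1 := by
  have hN' : N + 1 ≤ 1000 := by linarith
  -- lower bound: `prism_pos` uses the centring only for the upper bound; we redo both with `N ≤ 3`
  have hm0 : 0 < m := by nlinarith
  have hn0 : 0 < n := by linarith
  have hu0 : 0 ≤ u := by linarith
  have hNR : 0 ≤ (N + 1) * RA := by positivity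
  have hqr : 4 * (q + (N + 1) * RA) ≤ 3 * n := by nlinarith
  set L := W + (N + 1) * RA + Lb with hLdef
  have hL0 : 0 ≤ L := by rw [hLdef]; positivity
  simp only [one_mul]
  rw [min_eq_left (by nlinarith : -q - (N + 1) * RA - n ≤ N * n + q + (N + 1) * RA + n),
    max_eq_right (by nlinarith : -q - (N + 1) * RA - n ≤ N * n + q + (N + 1) * RA + n),
    min_eq_left (by linarith : -L ≤ L), max_eq_right (by linarith : -L ≤ L)]
  obtain ⟨-, hBx, hBn⟩ := prism_B (v := v) hn hm hsu hsu' hv hW hW0 hLb hLb0 hRA hRAℓ hN hN'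
  set Bmax := max (v * (su * (-L - 1))) (v * (su * L + su - 1))
  set Bmin := min (v * (su * (-L - 1))) (v * (su * L + su - 1))
  obtain ⟨f1, f2⟩ := coarse_bounds (u := u) (Λ := Λ) hm0
  set F := (800 * u * (800 * Λ) + 640000 * m / 2) / (640000 * m)
  obtain ⟨hΛ1, hΛ2⟩ := abs_le.1 hΛ
  have hFlo : -3 * u ≤ F := by
    by_contra hc; push Not at hc
    have h1 : 2 * m * F ≤ 2 * m * (-3 * u - 1) := mul_le_mul_of_nonneg_left (by linarith) (by positivity)
    nlinarith
  have hFhi : F ≤ 3 * u := by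
    by_contra hc; push Not at hc
    have h1 : 2 * m * (3 * u + 1) ≤ 2 * m * F := mul_le_mul_of_nonneg_left (by linarith) (by positivity)
    nlinarith
  constructor
  · obtain ⟨-, g2⟩ := incr_bounds (u := u) (m := m) (n := n) (a := -q - (N + 1) * RA - n) (B := Bmax) hu0 hm0 hn0
    set G := 800 * u * (800 * (m * (-q - (N + 1) * RA - n) - Bmax) / n) / (640000 * m)
    have e1 : u * (4 * (m * (-q - (N + 1) * RA - n))) ≥ u * (-(7 * m * n)) := by
      refine mul_le_mul_of_nonneg_left ?_ hu0
      have := mul_le_mul_of_nonneg_left hqr hm0.le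
      linarith
    have e2 : 2 * (u * Bmax) ≤ 9 * u * m * n := by
      have h1 : u * Bmax ≤ u * |Bmax| := mul_le_mul_of_nonneg_left (le_abs_self _) hu0
      have h2 := mul_le_mul_of_nonneg_left hBx hu0
      linarith
    have key : 800 * m * n * (G + 7 * u + 1) ≥ 600 * u * m * n - u * n := by linarith
    have hX : 0 ≤ G + 7 * u + 1 := by
      by_contra hc; push Not at hc
      have h1 : 800 * m * n * (G + 7 * u + 1) ≤ 800 * m * n * (-1) := mul_le_mul_of_nonneg_left (by linarith) (by positivity)
      have h2 : 0 ≤ u * n * (600 * m - 1) := mul_nonneg (mul_nonneg hu0 hn0.le) (by linarith)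
      have hmn : 0 < m * n := mul_pos hm0 hn0
      nlinarith
    linarith
  · obtain ⟨g1, -⟩ := incr_bounds (u := u) (m := m) (n := n) (a := N * n + q + (N + 1) * RA + n) (B := Bmin) hu0 hm0 hn0
    set G := 800 * u * (800 * (m * (N * n + q + (N + 1) * RA + n) - Bmin) / n) / (640000 * m)
    have e1 : u * (4 * (m * (N * n + q + (N + 1) * RA + n))) ≤ u * (4 * m * n * N + 7 * m * n) := by
      refine mul_le_mul_of_nonneg_left ?_ hu0
      have := mul_le_mul_of_nonneg_left hqr hm0.le
      linarith
    have e2 : 2 * (u * (-Bmin)) ≤ 9 * u * m * n := by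
      have h1 : u * (-Bmin) ≤ u * |Bmin| := mul_le_mul_of_nonneg_left (neg_le_abs _) hu0
      have h2 := mul_le_mul_of_nonneg_left hBn hu0
      linarith
    have key : 4 * (m * n * G) ≤ 4 * u * m * n * N + 25 * u * m * n := by linarith
    have hX : G ≤ u * N + 7 * u - 1 := by
      by_contra hc; push Not at hc
      have h1 : 4 * (m * n) * (u * N + 7 * u) ≤ 4 * (m * n) * G := mul_le_mul_of_nonneg_left (by linarith) (by positivity)
      have h2 : 0 < u * m * n := mul_pos (mul_pos (by linarith) hm0) hn0
      nlinarith
    have hN3' : u * N ≤ u * 3 := mul_le_mul_of_nonneg_left hN3 hu0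
    linarith

/-- **x-PREFIX PRISM ALONG, `σ = −1`, short run** (`N ≤ 3`). [cite: KozmaNitzan2024, §4 p. 28] -/
theorem prefix_neg {u m n su v ℓ W RA Lb q N Λ : ℤ} (hu : 1 ≤ u) (hn : 1 ≤ n) (hm : n * (ℓ - 1) < m) (hsu : n ≤ su) (hsu' : su ≤ 11 * n)
    (hv : |v| ≤ n) (hW : su * W ≤ n * ℓ + su) (hW0 : 0 ≤ W) (hLb : su * Lb ≤ 3 * (n * ℓ) + su) (hLb0 : 0 ≤ Lb)
    (hRA : 0 ≤ RA) (hRAn : 2000 * (RA + 2) ≤ n) (hRAℓ : 22000 * (RA + 2) ≤ ℓ)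
    (hq : 0 ≤ q) (hq' : 4 * q ≤ n) (hN : 0 ≤ N) (hN3 : N ≤ 3) (hΛ : |Λ| ≤ 3 * m) :
    -(5 * (40 * u)) + 1 ≤ -((800 * u * (800 * Λ) + 640000 * m / 2) / (640000 * m) +
        (800 * u * (800 * (m * (max ((-1) * (-q - (N + 1) * RA - n)) ((-1) * (N * n + q + (N + 1) * RA + n))) -
          min (v * (su * (min ((-1) * (-(W + (N + 1) * RA + Lb))) ((-1) * (W + (N + 1) * RA + Lb)) - 1))) (v * (su * (max ((-1) * (-(W + (N + 1) * RA + Lb))) ((-1) * (W + (N + 1) * RA + Lb))) + su - 1))) / n)) /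
          (640000 * m) + 1) ∧
      -((800 * u * (800 * Λ) + 640000 * m / 2) / (640000 * m) +
        (800 * u * (800 * (m * (min ((-1) * (-q - (N + 1) * RA - n)) ((-1) * (N * n + q + (N + 1) * RA + n))) -
          max (v * (su * (min ((-1) * (-(W + (N + 1) * RA + Lb))) ((-1) * (W + (N + 1) * RA + Lb)) - 1))) (v * (su * (max ((-1) * (-(W + (N + 1) * RA + Lb))) ((-1) * (W + (N + 1) * RA + Lb))) + su - 1))) / n)) /
          (640000 * m)) ≤ 25 * (40 * u) - 1 := by
  have hN' : N + 1 ≤ 1000 := by linarith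
  have hm0 : 0 < m := by nlinarith
  have hn0 : 0 < n := by linarith
  have hu0 : 0 ≤ u := by linarith
  have hNR : 0 ≤ (N + 1) * RA := by positivity
  have hqr : 4 * (q + (N + 1) * RA) ≤ 3 * n := by nlinarith
  set L := W + (N + 1) * RA + Lb with hLdef
  have hL0 : 0 ≤ L := by rw [hLdef]; positivity
  simp only [neg_mul, one_mul, neg_neg]
  rw [max_eq_left (by nlinarith : -(N * n + q + (N + 1) * RA + n) ≤ -(-q - (N + 1) * RA - n)),
    min_eq_right (by nlinarith : -(N * n + q + (N + 1) * RA + n) ≤ -(-q - (N + 1) * RA - n)),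
    min_eq_right (by linarith : -L ≤ L), max_eq_left (by linarith : -L ≤ L)]
  obtain ⟨-, hBx, hBn⟩ := prism_B (v := v) hn hm hsu hsu' hv hW hW0 hLb hLb0 hRA hRAℓ hN hN'
  set Bmax := max (v * (su * (-L - 1))) (v * (su * L + su - 1))
  set Bmin := min (v * (su * (-L - 1))) (v * (su * L + su - 1))
  obtain ⟨f1, f2⟩ := coarse_bounds (u := u) (Λ := Λ) hm0
  set F := (800 * u * (800 * Λ) + 640000 * m / 2) / (640000 * m)
  obtain ⟨hΛ1, hΛ2⟩ := abs_le.1 hΛ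
  have hFlo : -3 * u ≤ F := by
    by_contra hc; push Not at hc
    have h1 : 2 * m * F ≤ 2 * m * (-3 * u - 1) := mul_le_mul_of_nonneg_left (by linarith) (by positivity)
    nlinarith
  have hFhi : F ≤ 3 * u := by
    by_contra hc; push Not at hc
    have h1 : 2 * m * (3 * u + 1) ≤ 2 * m * F := mul_le_mul_of_nonneg_left (by linarith) (by positivity)
    nlinarith
  constructor
  · obtain ⟨g1, -⟩ := incr_bounds (u := u) (m := m) (n := n) (a := -(-q - (N + 1) * RA - n)) (B := Bmin) hu0 hm0 hn0
    set G := 800 * u * (800 * (m * -(-q - (N + 1) * RA - n) - Bmin) / n) / (640000 * m)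
    have e1 : u * (4 * (m * -(-q - (N + 1) * RA - n))) ≤ u * (7 * m * n) := by
      refine mul_le_mul_of_nonneg_left ?_ hu0
      have := mul_le_mul_of_nonneg_left hqr hm0.le
      linarith
    have e2 : 2 * (u * (-Bmin)) ≤ 9 * u * m * n := by
      have h1 : u * (-Bmin) ≤ u * |Bmin| := mul_le_mul_of_nonneg_left (neg_le_abs _) hu0
      have h2 := mul_le_mul_of_nonneg_left hBn hu0
      linarith
    have key : 4 * (m * n * G) ≤ 25 * u * m * n := by linarith
    have hX : G ≤ 7 * u - 1 := by
      by_contra hc; push Not at hc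
      have h1 : 4 * (m * n) * (7 * u) ≤ 4 * (m * n) * G := mul_le_mul_of_nonneg_left (by linarith) (by positivity)
      have h2 : 0 < u * m * n := mul_pos (mul_pos (by linarith) hm0) hn0
      nlinarith
    linarith
  · obtain ⟨-, g2⟩ := incr_bounds (u := u) (m := m) (n := n) (a := -(N * n + q + (N + 1) * RA + n)) (B := Bmax) hu0 hm0 hn0
    set G := 800 * u * (800 * (m * -(N * n + q + (N + 1) * RA + n) - Bmax) / n) / (640000 * m)
    have e1 : u * (4 * (m * -(N * n + q + (N + 1) * RA + n))) ≥ u * (-(4 * m * n * N) - 7 * m * n) := by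
      refine mul_le_mul_of_nonneg_left ?_ hu0
      have := mul_le_mul_of_nonneg_left hqr hm0.le
      linarith
    have e2 : 2 * (u * Bmax) ≤ 9 * u * m * n := by
      have h1 : u * Bmax ≤ u * |Bmax| := mul_le_mul_of_nonneg_left (le_abs_self _) hu0
      have h2 := mul_le_mul_of_nonneg_left hBx hu0
      linarith
    have key : 800 * m * n * (G + u * N + 7 * u + 1) ≥ 600 * u * m * n - u * n := by linarith
    have hX : 0 ≤ G + u * N + 7 * u + 1 := by
      by_contra hc; push Not at hc
      have h1 : 800 * m * n * (G + u * N + 7 * u + 1) ≤ 800 * m * n * (-1) := mul_le_mul_of_nonneg_left (by linarith) (by positivity)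
      have h2 : 0 ≤ u * n * (600 * m - 1) := mul_nonneg (mul_nonneg hu0 hn0.le) (by linarith)
      have hmn : 0 < m * n := mul_pos hm0 hn0
      nlinarith
    have hN3' : u * N ≤ u * 3 := mul_le_mul_of_nonneg_left hN3 hu0
    linarith

end RootArith

end NegB

end PlanarSkeletonNeg

end Summit.CriticalPhenomena.PercolationContinuityZ3.Theorems.Transplant
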